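import Summits.QuantumFields.BalabanUV.Beta.FP.TorusCompositeVertexJunctionSym
import Summits.QuantumFields.BalabanUV.Beta.CompositeVertexKernelRecTwo
import Summits.QuantumFields.BalabanUV.Beta.FP.TorusCompositeVertexJunctionTwo

/-!
# `BalabanUV.Beta.FP.TorusCompositeVertexJunctionTwoSym` — road «FP» for binder row D1, ROUTE T, (β1) «sym» column: **F5-Sym — THE ORDER-2 (C1) Q-JUNCTION FOR
# THE CENTRED SYM BRICKS, END TO END: OUR sym composite second-order insertion bi-jet `compIns₂₂Sym Lc M lev rs n h h′` IS, ENTRYWISE on the (multiplier, field)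
# slots (all pairs of copies at every box; the one-pair socket for boxes beyond the window guard), the torus insertion of the row's PACKED COMPOSITE SECOND-ORDER
# FAMILY `u_n • packVH (compVH2Ker ℓˢ 𝓋ˢ 𝓋₂ˢ Lc n · · · (κ,u) ·) (Lc^n)` over an1's CENTRED SYM bricks `ℓˢ := symLinKerAt (ctr (d+1) Lc) Lc`,
# `𝓋ˢ := symVhKerAt (ctr (d+1) Lc) Lc`, `𝓋₂ˢ := ½ (symVh2KerAt (ctr (d+1) Lc) Lc · g g₁ g₂ + · g g₂ g₁)`, unit `u_n = (∏_{i<n} stepScale d Lc (lev (i+1))) · #box^n`**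
# — no hypothesis beyond `hc` (the (β1) twin of `TorusCompositeVertexJunctionTwo`; an2's brick-parametric `compVH2Ker` (`CompositeVertexKernelRecTwo`) fed the sym bricks)

WHAT.  §1 plumbing (copies of the rooted file's `mul_pairing₂_eq ∕ add4_eq ∕ abs_sub_le_of_mem_winF`; NEW `packVH₂_translate` — the joint block covariance of a
packed TWO-bond family from the three-bond covariance of its kernel, an1's `packVH_translate` one bond up).  §2 **`symKernelFunctionals₂_spec`** — a TRIPLE
`(𝓡, 𝓘₁, 𝓘₂)` satisfying the six clauses of `TorusCompositeInsertionPeriodicTwoSym` (`hR0 hRsucc h0₁ hsucc₁ h0₂ hsucc₂`; the first four are F4-Sym's pair) whose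
order-2 member is the bi-pairing against `u_n · compVH2Ker ℓˢ 𝓋ˢ 𝓋₂ˢ Lc n` (R-13 `pairing₂_of_kernel_succ` at an2's four-summand top peel `compVH2Ker_succ`, read
backwards; an1's sym brick windows; units `u_{n+1} = θ₂ u′³ = θ u′² = stepScale · Lc^{d+1} · u′`).  §3 **`sum_sum_mul_tsum₂_compVh2S_eq_compIns₂₂Sym_apply`** (all pairs
of copies, every box) and **`perZ_dper_compVh2S_eq_compIns₂₂Sym_apply_single_of_lt`** (the one-pair socket = the `-Sym` door's `hQF₂` at the row's sym family, for boxes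
with `wid Lc n + |u i − u′ i| < T i`) — `TorusCompositeInsertionKernelPackedSym` §2 with `hWt := packVH₂_translate … (compVH2Ker_sh …)` over an1's
`symLinKerAt_add ∕ symVhKerAt_add ∕ symVh2KerAt_add`.  (an2's packed name `compVh2S` is not yet in the tree; the family is written as its `packVH` body.)
[folklore] BY NAME; no `def`, nothing cited, 0 sorry; NO chart; nothing of Bałaban's asserted — that this packed sym family IS the (β1) tower's dressed second vertex
through the corrector is an2's (C1) TABLE word; the carriers' NAMES are the row's to give.

HONEST DEPENDENCY (page 1, mandatory): continuum YM on T⁴ ⇐ BetaPertH ∧ nine spine estimates (0/9 proved); BetaPertH ⇐ (D1) ∧ (D4) ∧ CAP+tail;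
G-an2-4 gates asym, D1 and NE2/3/4.  HONEST FRAMING (cell contract, verbatim): «discharging `BetaPertH` makes Bałaban's UV stability UNCONDITIONAL —
a real constructive-QFT result; it is NOT the continuum limit and NOT the Clay problem.»  ABSOLUTE RULE (cell charter, verbatim): «No internally-minted
statement may enter as a cited fact. Every hypothesis is either kernel-proved in this package or a verbatim quotation of a PUBLISHED theorem with page
reference. The manuscript(s) under audit are NOT citable for their own disputed steps — they are the thing under adjudication; programme-internal
(2001/route/tribunal) claims are never citable.»  0 estimates; 0∕4 row-D1 binders (hW, hR, D1Tel, D1Rep); NOT (T-ID), NOT (C1), NOT SDF, NOT D1,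
NOT BetaPertH, NOT continuum, NOT Clay.  D1 formalisation swarm LEAF PROVER 02 (b2b-balaban-beta-d1-formalise-leaf-02 gen 32), 2026-08-24.  No existing file touched.
v1.1 (leaf-02 g33, 2026-08-25): the three kernel-generic letters `mul_pairing₂_eq ∕ add4_eq ∕ abs_sub_le_of_mem_winF` are READ BY NAME from the rooted F4₂ `TorusCompositeVertexJunctionTwo` (R-17), and R-16's four letters from `TorusCompositeVertexJunction`, instead of re-typed (`dedup.landed` is α-invariant); the other declarations byte-identical to v1 ff5c7e62a3b7aade.
-/

noncomputable section

open scoped BigOperators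

namespace Summit.QuantumFields.BalabanUV.Beta.FP.TorusCompositeVertexJunctionTwoSym

open Finset
open Literature.MathematicalPhysics.QuantumFieldTheory
open Literature.MathematicalPhysics.QuantumFieldTheory.Balaban1983to89
open Literature.MathematicalPhysics.QuantumFieldTheory.Balaban1983to89.Beta
open B6Lemma24Torus (pbox)
open B4TorusKernel.MultiPeriod (translate)
open ExpKernelCalculus (MKer shiftK)
open AffineAveraging (Site Form1 box toSite)
open AveragingContours (off blk)
open AveragingContoursRooted (ctr ctrOff)
open AveragingHessianKernels (Bond Near packVH packVH_inl_inr packVH_inr_inl off_add_smul blk_add_smul)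
open OneStepResolventKernel (Fib)
open Summit.QuantumFields.BalabanUV.Beta.BorderedHessian (stepScale stepScale_ne_zero)
open Summit.QuantumFields.BalabanUV.Beta.SymAveragingHessianCounts (symLinKerAt symVhKerAt symLinKerAt_eq_zero symLinKerAt_add symVhKerAt_add)
open Summit.QuantumFields.BalabanUV.Beta.SymAveragingMixedJetTables (symVh2KerAt symVh2KerAt_add)
open Summit.QuantumFields.BalabanUV.Beta.FP.KernelPeriodisationFib (perZ)
open Summit.QuantumFields.BalabanUV.Beta.FP.KernelPeriodisationFibLoc (dper)
open Summit.QuantumFields.BalabanUV.Beta.FP.TorusGaugeCovariancePairing (wrapPt)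
open Summit.QuantumFields.BalabanUV.Beta.FP.TorusCompositeObjects (towerTorus)
open Summit.QuantumFields.BalabanUV.Beta.FP.TorusCompositeCovarianceOne (prod_stepScale_mul_card_ne_zero')
open Summit.QuantumFields.BalabanUV.Beta.FP.TorusCompositeCovarianceTwo (card_box_cast)
open Summit.QuantumFields.BalabanUV.Beta.FP.TorusCompositeCovarianceTwoPolarSym (compIns₂₂Sym)
open Summit.QuantumFields.BalabanUV.Beta.FP.TorusStepInsertionSym (symVhKerAt_ctr_eq_zero_left symVhKerAt_ctr_eq_zero_right)
open Summit.QuantumFields.BalabanUV.Beta.FP.TorusStepInsertionSymTwo (symVh2KerAt_ctr_eq_zero_of_not_near)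
open Summit.QuantumFields.BalabanUV.Beta.CompositeVertexKernelRec (offs near_iff_exists_offs winF wid mem_winF_iff compLinKer compVHKer compVH2Ker
  compLinKer_zero compLinKer_succ compVH2Ker_zero compVH2Ker_succ compLinKer_eq_zero compVHKer_eq_zero_left compVHKer_eq_zero_right compVH2Ker_eq_zero_fluct
  compVH2Ker_eq_zero_left compVH2Ker_eq_zero_right compVH2Ker_sh)
open Summit.QuantumFields.BalabanUV.Beta.FP.CompositeKernelFunctionalStep (tsum_sum_eq_finset_sum pairing₂_of_kernel_succ)
open Summit.QuantumFields.BalabanUV.Beta.FP.TorusCompositeInsertionKernelPackedSym (sum_sum_mul_tsum₂_packVH_eq_compIns₂₂Sym_apply perZ_dper_packVH_eq_compIns₂₂Sym_apply_single_of_diam)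
open Summit.QuantumFields.BalabanUV.Beta.FP.TorusCompositeVertexJunctionSym (symKernelFunctionals_spec)
open Summit.QuantumFields.BalabanUV.Beta.FP.TorusCompositeVertexJunction (mul_pairing_eq not_near_of_not_mem_window sum_window_eq sigma_eq)
open Summit.QuantumFields.BalabanUV.Beta.FP.TorusCompositeVertexJunctionTwo (mul_pairing₂_eq add4_eq abs_sub_le_of_mem_winF)

variable {d : ℕ} (Lc : ℕ) [NeZero Lc]

/-! ## §1 Plumbing -/

omit [NeZero Lc] in
/-- [folklore] **JOINT BLOCK COVARIANCE OF A PACKED TWO-BOND FAMILY** (an1's `packVH_translate` one bond up): if the three-bond kernel `K₂` is covariant under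
simultaneous block translations of the coarse site and its three fine bonds, the packed family `(κ,u), (κ′,u′) ↦ packVH (K₂ · · · (κ,u) ·) N κ′ u′` obeys the shape
`hWt` of `TorusCompositeInsertionKernelTwoSym ∕ …KernelPackedSym` §2. -/
theorem packVH₂_translate {N : ℕ} (hN : 1 ≤ N) (K₂ : Fin (d + 1) → Site (d + 1) → Bond (d + 1) → Bond (d + 1) → Bond (d + 1) → ℝ)
    (hK : ∀ (μ : Fin (d + 1)) (y t : Site (d + 1)) (f g g' : Bond (d + 1)),
      K₂ μ (y + t) (f.sh ((N : ℤ) • t)) (g.sh ((N : ℤ) • t)) (g'.sh ((N : ℤ) • t)) = K₂ μ y f g g')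
    (κ : Fin (d + 1)) (u : Site (d + 1)) (κ' : Fin (d + 1)) (u' t : Site (d + 1)) :
    packVH (fun μ y f f' => K₂ μ y f (κ, u + (N : ℤ) • t) f') N κ' (u' + (N : ℤ) • t)
      = shiftK (-((N : ℤ) • t)) (packVH (fun μ y f f' => K₂ μ y f (κ, u) f') N κ' u') := by
  funext x z a b
  simp only [shiftK]
  have e1 : ∀ w : Site (d + 1), w + -((N : ℤ) • t) = w + (N : ℤ) • (-t) := fun w => by rw [smul_neg]
  rcases a with α | μ <;> rcases b with α' | μ'
  · rfl
  · rw [packVH_inl_inr, packVH_inl_inr, e1, e1, off_add_smul, blk_add_smul hN]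
    split_ifs with hz
    · have := hK μ' (blk N z + -t) t (α, x + (N : ℤ) • -t) (κ, u) (κ', u')
      rw [neg_add_cancel_right] at this
      rw [← this]
      congr 1
      simp [AveragingHessianKernels.Bond.sh, smul_neg]
    · rfl
  · rw [packVH_inr_inl, packVH_inr_inl, e1, e1, off_add_smul, blk_add_smul hN]
    split_ifs with hx
    · have := hK μ (blk N x + -t) t (α', z + (N : ℤ) • -t) (κ, u) (κ', u')
      rw [neg_add_cancel_right] at this
      rw [← this]
      congr 1
      simp [AveragingHessianKernels.Bond.sh, smul_neg]
    · rfl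
  · rfl

/-! ## §2 The triple of kernel functionals of the centred sym bricks -/

/-- [folklore] **`symKernelFunctionals₂_spec` — FUNCTIONALS `(𝓡, 𝓘₁, 𝓘₂)` SATISFYING THE SIX CLAUSES OF `TorusCompositeInsertionPeriodicTwoSym`** (`(𝓡, 𝓘₁)` are F4-Sym's
pair; `𝓘₂` is DEFINED as the bi-pairing against `u_n · compVH2Ker ℓˢ 𝓋ˢ 𝓋₂ˢ Lc n` and its successor clause is R-13's `pairing₂_of_kernel_succ` at an2's four-summand top peel
`compVH2Ker_succ`, read backwards, with an1's sym brick windows (`symVhKerAt_ctr_eq_zero_left ∕ _right`, `symVh2KerAt_ctr_eq_zero_of_not_near`, `symLinKerAt_eq_zero`), an2's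
composite windows, and the units `u_{n+1} = θ₂ u′³ = θ u′² = stepScale d Lc (lev 1) · Lc^{d+1} · u′`).  The last conjunct is the order-2 kernel identity
`𝓘₂ lev n H H′ B κ₀ x = u_n · Σ'_u Σ_κ (Σ'_{u′} Σ_{κ′} (Σ'_z Σ_l compVH2Ker ℓˢ 𝓋ˢ 𝓋₂ˢ Lc n κ₀ x (l,z) (κ,u) (κ′,u′) · B l z) · H′ κ′ u′) · H κ u`. -/
theorem symKernelFunctionals₂_spec (hc : ctrOff (d + 1) Lc ∈ box (d + 1) Lc) :
    ∃ (𝓡 : (ℕ → ℕ) → ℕ → Form1 (d + 1) ℝ → Form1 (d + 1) ℝ) (𝓘₁ : (ℕ → ℕ) → ℕ → Form1 (d + 1) ℝ → Form1 (d + 1) ℝ → Form1 (d + 1) ℝ)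
      (𝓘₂ : (ℕ → ℕ) → ℕ → Form1 (d + 1) ℝ → Form1 (d + 1) ℝ → Form1 (d + 1) ℝ → Form1 (d + 1) ℝ),
      (∀ (lev : ℕ → ℕ) (B : Form1 (d + 1) ℝ), 𝓡 lev 0 B = B) ∧
      (∀ (lev : ℕ → ℕ) (n : ℕ) (B : Form1 (d + 1) ℝ) (κ : Fin (d + 1)) (x : Site (d + 1)),
        𝓡 lev (n + 1) B κ x = stepScale d Lc (lev 1) * ((Lc : ℝ) ^ (d + 1)
          * ∑' z : Site (d + 1), ∑ l : Fin (d + 1), symLinKerAt (ctr (d + 1) Lc) Lc κ x (l, z) * 𝓡 (fun k => lev (k + 1)) n B l z)) ∧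
      (∀ (lev : ℕ → ℕ) (H B : Form1 (d + 1) ℝ), 𝓘₁ lev 0 H B = 0) ∧
      (∀ (lev : ℕ → ℕ) (n : ℕ) (H B : Form1 (d + 1) ℝ) (κ : Fin (d + 1)) (x : Site (d + 1)),
        𝓘₁ lev (n + 1) H B κ x
          = (((Lc : ℝ) ^ (d + 1) * stepScale d Lc (lev 1)) * (∏ i ∈ Finset.range n, (stepScale d Lc (lev (i + 1 + 1)) * ((box (d + 1) Lc).card : ℝ)))⁻¹) *
              (∑' u : Site (d + 1), ∑ κ' : Fin (d + 1),
                (∑' z : Site (d + 1), ∑ l : Fin (d + 1), symVhKerAt (ctr (d + 1) Lc) Lc κ x (l, z) (κ', u) * 𝓡 (fun k => lev (k + 1)) n B l z) *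
                  𝓡 (fun k => lev (k + 1)) n H κ' u)
            + stepScale d Lc (lev 1) * ((Lc : ℝ) ^ (d + 1) *
                ∑' z : Site (d + 1), ∑ l : Fin (d + 1), symLinKerAt (ctr (d + 1) Lc) Lc κ x (l, z) * 𝓘₁ (fun k => lev (k + 1)) n H B l z)) ∧
      (∀ (lev : ℕ → ℕ) (H H' B : Form1 (d + 1) ℝ), 𝓘₂ lev 0 H H' B = 0) ∧
      (∀ (lev : ℕ → ℕ) (n : ℕ) (H H' B : Form1 (d + 1) ℝ) (κ₀ : Fin (d + 1)) (x : Site (d + 1)),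
        𝓘₂ lev (n + 1) H H' B κ₀ x
          = ((((Lc : ℝ) ^ (d + 1) * stepScale d Lc (lev 1)) * (∏ i ∈ Finset.range n, (stepScale d Lc (lev (i + 1 + 1)) * ((box (d + 1) Lc).card : ℝ)))⁻¹)
              * (∏ i ∈ Finset.range n, (stepScale d Lc (lev (i + 1 + 1)) * ((box (d + 1) Lc).card : ℝ)))⁻¹) *
              (∑' u : Site (d + 1), ∑ κ : Fin (d + 1), (∑' u' : Site (d + 1), ∑ κ' : Fin (d + 1),
                (∑' z : Site (d + 1), ∑ l : Fin (d + 1),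
                  (1 / 2 : ℝ) * (symVh2KerAt (ctr (d + 1) Lc) Lc κ₀ x (l, z) (κ, u) (κ', u') + symVh2KerAt (ctr (d + 1) Lc) Lc κ₀ x (l, z) (κ', u') (κ, u)) *
                    𝓡 (fun k => lev (k + 1)) n B l z) *
                𝓡 (fun k => lev (k + 1)) n H' κ' u') * 𝓡 (fun k => lev (k + 1)) n H κ u)
            + (((Lc : ℝ) ^ (d + 1) * stepScale d Lc (lev 1)) * (∏ i ∈ Finset.range n, (stepScale d Lc (lev (i + 1 + 1)) * ((box (d + 1) Lc).card : ℝ)))⁻¹) *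
              ((∑' u : Site (d + 1), ∑ κ' : Fin (d + 1),
                (∑' z : Site (d + 1), ∑ l : Fin (d + 1), symVhKerAt (ctr (d + 1) Lc) Lc κ₀ x (l, z) (κ', u) * 𝓘₁ (fun k => lev (k + 1)) n H' B l z) *
                  𝓡 (fun k => lev (k + 1)) n H κ' u)
              + (∑' u : Site (d + 1), ∑ κ' : Fin (d + 1),
                (∑' z : Site (d + 1), ∑ l : Fin (d + 1), symVhKerAt (ctr (d + 1) Lc) Lc κ₀ x (l, z) (κ', u) * 𝓘₁ (fun k => lev (k + 1)) n H B l z) *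
                  𝓡 (fun k => lev (k + 1)) n H' κ' u))
            + stepScale d Lc (lev 1) * ((Lc : ℝ) ^ (d + 1) *
                ∑' z : Site (d + 1), ∑ l : Fin (d + 1), symLinKerAt (ctr (d + 1) Lc) Lc κ₀ x (l, z) * 𝓘₂ (fun k => lev (k + 1)) n H H' B l z)) ∧
      (∀ (lev : ℕ → ℕ) (n : ℕ) (H H' B : Form1 (d + 1) ℝ) (κ₀ : Fin (d + 1)) (x : Site (d + 1)), 𝓘₂ lev n H H' B κ₀ x
          = ((∏ i ∈ range n, stepScale d Lc (lev (i + 1))) * ((box (d + 1) Lc).card : ℝ) ^ n) *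
              ∑' u : Site (d + 1), ∑ κ : Fin (d + 1), (∑' u' : Site (d + 1), ∑ κ' : Fin (d + 1), (∑' z : Site (d + 1), ∑ l : Fin (d + 1),
                compVH2Ker (fun _ : ℕ => symLinKerAt (ctr (d + 1) Lc) Lc) (fun _ : ℕ => symVhKerAt (ctr (d + 1) Lc) Lc)
                  (fun (_ : ℕ) μ y g g₁ g₂ => (1 / 2 : ℝ) * (symVh2KerAt (ctr (d + 1) Lc) Lc μ y g g₁ g₂ + symVh2KerAt (ctr (d + 1) Lc) Lc μ y g g₂ g₁)) Lc n κ₀ x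
                    (l, z) (κ, u) (κ', u') * B l z) * H' κ' u') * H κ u) := by
  classical
  obtain ⟨R, I, hR0, hRsucc, h0, hsucc, hR, hI⟩ := symKernelFunctionals_spec (d := d) Lc hc
  obtain ⟨I₂, hI₂⟩ : ∃ I₂ : (ℕ → ℕ) → ℕ → Form1 (d + 1) ℝ → Form1 (d + 1) ℝ → Form1 (d + 1) ℝ → Form1 (d + 1) ℝ,
      ∀ (lev : ℕ → ℕ) (n : ℕ) (H H' B : Form1 (d + 1) ℝ) (κ₀ : Fin (d + 1)) (x : Site (d + 1)), I₂ lev n H H' B κ₀ x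
        = ((∏ i ∈ range n, stepScale d Lc (lev (i + 1))) * ((box (d + 1) Lc).card : ℝ) ^ n) *
            ∑' u : Site (d + 1), ∑ κ : Fin (d + 1), (∑' u' : Site (d + 1), ∑ κ' : Fin (d + 1), (∑' z : Site (d + 1), ∑ l : Fin (d + 1),
              compVH2Ker (fun _ : ℕ => symLinKerAt (ctr (d + 1) Lc) Lc) (fun _ : ℕ => symVhKerAt (ctr (d + 1) Lc) Lc)
                (fun (_ : ℕ) μ y g g₁ g₂ => (1 / 2 : ℝ) * (symVh2KerAt (ctr (d + 1) Lc) Lc μ y g g₁ g₂ + symVh2KerAt (ctr (d + 1) Lc) Lc μ y g g₂ g₁)) Lc n κ₀ x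
                  (l, z) (κ, u) (κ', u') * B l z) * H' κ' u') * H κ u :=
    ⟨fun lev n H H' B κ₀ x => _, fun _ _ _ _ _ _ _ => rfl⟩
  -- units
  have hu : ∀ (lev : ℕ → ℕ) (n : ℕ), (∏ i ∈ range (n + 1), stepScale d Lc (lev (i + 1))) * ((box (d + 1) Lc).card : ℝ) ^ (n + 1)
      = stepScale d Lc (lev 1) * (Lc : ℝ) ^ (d + 1) * ((∏ i ∈ range n, stepScale d Lc (lev (i + 1 + 1))) * ((box (d + 1) Lc).card : ℝ) ^ n) := fun lev n => by
    rw [Finset.prod_range_succ', Nat.zero_add, pow_succ, ← card_box_cast Lc]; ring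
  refine ⟨R, I, I₂, hR0, hRsucc, h0, hsucc, fun lev H H' B => ?_, fun lev n H H' B κ₀ x => ?_, hI₂⟩
  · -- `h0₂`: no second jet at depth 0
    funext κ₀ x
    rw [hI₂]
    simp only [compVH2Ker_zero, zero_mul, Finset.sum_const_zero, tsum_zero, mul_zero]
    rfl
  · -- `hsucc₂`
    obtain ⟨P, hP⟩ : ∃ P : Finset (Bond (d + 1)),
        P = ((Finset.univ : Finset (Fin (d + 1))) ×ˢ offs Lc).image (fun p : Fin (d + 1) × Site (d + 1) => ((p.1, (Lc : ℤ) • x + p.2) : Bond (d + 1))) :=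
      ⟨_, rfl⟩
    have h0' : (∏ i ∈ range n, (stepScale d Lc (lev (i + 1 + 1)) * ((box (d + 1) Lc).card : ℝ))) ≠ 0 :=
      prod_stepScale_mul_card_ne_zero' Lc ⟨ctrOff (d + 1) Lc, hc⟩ (fun i => lev (i + 1 + 1)) n
    -- the unit identities (`Π = u′` by `sigma_eq`)
    have hθ : ((Lc : ℝ) ^ (d + 1) * stepScale d Lc (lev 1)) * (∏ i ∈ range n, (stepScale d Lc (lev (i + 1 + 1)) * ((box (d + 1) Lc).card : ℝ)))⁻¹
          * ((∏ i ∈ range n, stepScale d Lc (lev (i + 1 + 1))) * ((box (d + 1) Lc).card : ℝ) ^ n)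
          * ((∏ i ∈ range n, stepScale d Lc (lev (i + 1 + 1))) * ((box (d + 1) Lc).card : ℝ) ^ n)
        = (∏ i ∈ range (n + 1), stepScale d Lc (lev (i + 1))) * ((box (d + 1) Lc).card : ℝ) ^ (n + 1) := by
      rw [hu, ← sigma_eq Lc lev n, mul_assoc ((Lc : ℝ) ^ (d + 1) * stepScale d Lc (lev 1)) _ _, inv_mul_cancel₀ h0', mul_one]
      ring
    have hθ₂ : ((Lc : ℝ) ^ (d + 1) * stepScale d Lc (lev 1)) * (∏ i ∈ range n, (stepScale d Lc (lev (i + 1 + 1)) * ((box (d + 1) Lc).card : ℝ)))⁻¹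
          * (∏ i ∈ range n, (stepScale d Lc (lev (i + 1 + 1)) * ((box (d + 1) Lc).card : ℝ)))⁻¹
          * ((∏ i ∈ range n, stepScale d Lc (lev (i + 1 + 1))) * ((box (d + 1) Lc).card : ℝ) ^ n)
          * ((∏ i ∈ range n, stepScale d Lc (lev (i + 1 + 1))) * ((box (d + 1) Lc).card : ℝ) ^ n)
          * ((∏ i ∈ range n, stepScale d Lc (lev (i + 1 + 1))) * ((box (d + 1) Lc).card : ℝ) ^ n)
        = (∏ i ∈ range (n + 1), stepScale d Lc (lev (i + 1))) * ((box (d + 1) Lc).card : ℝ) ^ (n + 1) := by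
      rw [hu, ← sigma_eq Lc lev n]
      have h1 : (∏ i ∈ range n, (stepScale d Lc (lev (i + 1 + 1)) * ((box (d + 1) Lc).card : ℝ)))⁻¹
          * (∏ i ∈ range n, (stepScale d Lc (lev (i + 1 + 1)) * ((box (d + 1) Lc).card : ℝ))) = 1 := inv_mul_cancel₀ h0'
      calc ((Lc : ℝ) ^ (d + 1) * stepScale d Lc (lev 1)) * (∏ i ∈ range n, (stepScale d Lc (lev (i + 1 + 1)) * ((box (d + 1) Lc).card : ℝ)))⁻¹
            * (∏ i ∈ range n, (stepScale d Lc (lev (i + 1 + 1)) * ((box (d + 1) Lc).card : ℝ)))⁻¹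
            * (∏ i ∈ range n, (stepScale d Lc (lev (i + 1 + 1)) * ((box (d + 1) Lc).card : ℝ)))
            * (∏ i ∈ range n, (stepScale d Lc (lev (i + 1 + 1)) * ((box (d + 1) Lc).card : ℝ)))
            * (∏ i ∈ range n, (stepScale d Lc (lev (i + 1 + 1)) * ((box (d + 1) Lc).card : ℝ)))
          = ((Lc : ℝ) ^ (d + 1) * stepScale d Lc (lev 1))
            * ((∏ i ∈ range n, (stepScale d Lc (lev (i + 1 + 1)) * ((box (d + 1) Lc).card : ℝ)))⁻¹
              * (∏ i ∈ range n, (stepScale d Lc (lev (i + 1 + 1)) * ((box (d + 1) Lc).card : ℝ))))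
            * ((∏ i ∈ range n, (stepScale d Lc (lev (i + 1 + 1)) * ((box (d + 1) Lc).card : ℝ)))⁻¹
              * (∏ i ∈ range n, (stepScale d Lc (lev (i + 1 + 1)) * ((box (d + 1) Lc).card : ℝ))))
            * (∏ i ∈ range n, (stepScale d Lc (lev (i + 1 + 1)) * ((box (d + 1) Lc).card : ℝ))) := by ring
        _ = _ := by rw [h1]; ring
    rw [hI₂, mul_pairing₂_eq]
    refine pairing₂_of_kernel_succ P
      (((Lc : ℝ) ^ (d + 1) * stepScale d Lc (lev 1)) * (∏ i ∈ range n, (stepScale d Lc (lev (i + 1 + 1)) * ((box (d + 1) Lc).card : ℝ)))⁻¹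
        * (∏ i ∈ range n, (stepScale d Lc (lev (i + 1 + 1)) * ((box (d + 1) Lc).card : ℝ)))⁻¹)
      (((Lc : ℝ) ^ (d + 1) * stepScale d Lc (lev 1)) * (∏ i ∈ range n, (stepScale d Lc (lev (i + 1 + 1)) * ((box (d + 1) Lc).card : ℝ)))⁻¹)
      (stepScale d Lc (lev 1)) κ₀ x (symVhKerAt (ctr (d + 1) Lc) Lc κ₀ x)
      (fun g g' hg => hg.elim (fun hg => symVhKerAt_ctr_eq_zero_left Lc hc (not_near_of_not_mem_window Lc x hP hg) g')
        fun hg' => symVhKerAt_ctr_eq_zero_right Lc hc g (not_near_of_not_mem_window Lc x hP hg'))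
      (fun g g₁ g₂ => (1 / 2 : ℝ) * (symVh2KerAt (ctr (d + 1) Lc) Lc κ₀ x g g₁ g₂ + symVh2KerAt (ctr (d + 1) Lc) Lc κ₀ x g g₂ g₁)) (fun g g₁ g₂ hg => ?_)
      (fun g => (Lc : ℝ) ^ (d + 1) * symLinKerAt (ctr (d + 1) Lc) Lc κ₀ x g)
      (fun g hg => mul_eq_zero_of_right _ (symLinKerAt_eq_zero hc (not_near_of_not_mem_window Lc x hP hg)))
      (fun F => fun κ₁ y => (Lc : ℝ) ^ (d + 1) * ∑' z : Site (d + 1), ∑ l : Fin (d + 1), symLinKerAt (ctr (d + 1) Lc) Lc κ₁ y (l, z) * F l z) (fun F => ?_)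
      (fun g f => ((∏ i ∈ range n, stepScale d Lc (lev (i + 1 + 1))) * ((box (d + 1) Lc).card : ℝ) ^ n)
        * compLinKer (fun _ : ℕ => symLinKerAt (ctr (d + 1) Lc) Lc) Lc n f g)
      (fun g => winF (Lc ^ n) (wid Lc n) g.2) (fun g m w hw => mul_eq_zero_of_right _ (compLinKer_eq_zero n (f := (m, w)) hw))
      (R (fun k => lev (k + 1)) n) (fun B' g => ?_)
      (fun g f f' => ((∏ i ∈ range n, stepScale d Lc (lev (i + 1 + 1))) * ((box (d + 1) Lc).card : ℝ) ^ n)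
        * compVHKer (fun _ : ℕ => symLinKerAt (ctr (d + 1) Lc) Lc) (fun _ : ℕ => symVhKerAt (ctr (d + 1) Lc) Lc) Lc n g.1 g.2 f f')
      (fun g => winF (Lc ^ n) (wid Lc n) g.2) (fun g l f' z hz => mul_eq_zero_of_right _ (compVHKer_eq_zero_left n (f := (l, z)) f' hz))
      (fun g f κ' u hu => mul_eq_zero_of_right _ (compVHKer_eq_zero_right n f (f' := (κ', u)) hu))
      (I (fun k => lev (k + 1)) n) (fun H₁ B' g => ?_)
      (fun g f f₁ f₂ => ((∏ i ∈ range n, stepScale d Lc (lev (i + 1 + 1))) * ((box (d + 1) Lc).card : ℝ) ^ n)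
        * compVH2Ker (fun _ : ℕ => symLinKerAt (ctr (d + 1) Lc) Lc) (fun _ : ℕ => symVhKerAt (ctr (d + 1) Lc) Lc)
          (fun (_ : ℕ) μ y g g₁ g₂ => (1 / 2 : ℝ) * (symVh2KerAt (ctr (d + 1) Lc) Lc μ y g g₁ g₂ + symVh2KerAt (ctr (d + 1) Lc) Lc μ y g g₂ g₁)) Lc n g.1 g.2 f f₁ f₂)
      (fun g => winF (Lc ^ n) (wid Lc n) g.2)
      (fun g l f₁ f₂ z hz => mul_eq_zero_of_right _ (compVH2Ker_eq_zero_fluct n (f := (l, z)) f₁ f₂ hz))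
      (fun g f κ₁ f₂ u hu => mul_eq_zero_of_right _ (compVH2Ker_eq_zero_left n f (b := (κ₁, u)) f₂ hu))
      (fun g f f₁ κ₂ u hu => mul_eq_zero_of_right _ (compVH2Ker_eq_zero_right n f f₁ (b' := (κ₂, u)) hu))
      (I₂ (fun k => lev (k + 1)) n) (fun H₁ H₂ B' g => ?_)
      (fun f f₁ f₂ => ((∏ i ∈ range (n + 1), stepScale d Lc (lev (i + 1))) * ((box (d + 1) Lc).card : ℝ) ^ (n + 1))
        * compVH2Ker (fun _ : ℕ => symLinKerAt (ctr (d + 1) Lc) Lc) (fun _ : ℕ => symVhKerAt (ctr (d + 1) Lc) Lc)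
          (fun (_ : ℕ) μ y g g₁ g₂ => (1 / 2 : ℝ) * (symVh2KerAt (ctr (d + 1) Lc) Lc μ y g g₁ g₂ + symVh2KerAt (ctr (d + 1) Lc) Lc μ y g g₂ g₁)) Lc (n + 1) κ₀ x f f₁ f₂)
      (fun f f₁ f₂ => ?_) B H' H
    · -- `hvh2`: an1's window for the second sym table, both orientations
      rcases hg with hg | hg | hg
      · have h1 := not_near_of_not_mem_window Lc x hP hg
        rw [symVh2KerAt_ctr_eq_zero_of_not_near Lc hc κ₀ x (Or.inl h1), symVh2KerAt_ctr_eq_zero_of_not_near Lc hc κ₀ x (Or.inl h1), add_zero, mul_zero]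
      · have h1 := not_near_of_not_mem_window Lc x hP hg
        rw [symVh2KerAt_ctr_eq_zero_of_not_near Lc hc κ₀ x (Or.inr (Or.inl h1)), symVh2KerAt_ctr_eq_zero_of_not_near Lc hc κ₀ x (Or.inr (Or.inr h1)),
          add_zero, mul_zero]
      · have h1 := not_near_of_not_mem_window Lc x hP hg
        rw [symVh2KerAt_ctr_eq_zero_of_not_near Lc hc κ₀ x (Or.inr (Or.inr h1)), symVh2KerAt_ctr_eq_zero_of_not_near Lc hc κ₀ x (Or.inr (Or.inl h1)),
          add_zero, mul_zero]
    · -- `hAf`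
      show (Lc : ℝ) ^ (d + 1) * (∑' z : Site (d + 1), ∑ l : Fin (d + 1), symLinKerAt (ctr (d + 1) Lc) Lc κ₀ x (l, z) * F l z) = _
      rw [← tsum_mul_left]
      exact tsum_congr fun z => by rw [Finset.mul_sum]; exact Finset.sum_congr rfl fun l _ => (mul_assoc _ _ _).symm
    · -- `hCf`
      obtain ⟨l, z⟩ := g
      rw [hR, ← tsum_mul_left]
      exact tsum_congr fun w => by rw [Finset.mul_sum]; exact Finset.sum_congr rfl fun m _ => (mul_assoc _ _ _).symm
    · -- `hℐ₁`
      rw [hI]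
      exact mul_pairing_eq _ (compVHKer (fun _ : ℕ => symLinKerAt (ctr (d + 1) Lc) Lc) (fun _ : ℕ => symVhKerAt (ctr (d + 1) Lc) Lc) Lc n g.1 g.2) B' H₁
    · -- `hℐ₂`
      rw [hI₂]
      exact mul_pairing₂_eq _ (compVH2Ker (fun _ : ℕ => symLinKerAt (ctr (d + 1) Lc) Lc) (fun _ : ℕ => symVhKerAt (ctr (d + 1) Lc) Lc)
        (fun (_ : ℕ) μ y g g₁ g₂ => (1 / 2 : ℝ) * (symVh2KerAt (ctr (d + 1) Lc) Lc μ y g g₁ g₂ + symVh2KerAt (ctr (d + 1) Lc) Lc μ y g g₂ g₁)) Lc n g.1 g.2) B' H₂ H₁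
    · -- `h𝒲′`: an2's four-summand top peel + the units
      rw [compVH2Ker_succ, mul_add, mul_add, mul_add]
      refine add4_eq ?_ ?_ ?_ ?_
      · simp only [sum_window_eq Lc x hP, Finset.mul_sum]
        refine Finset.sum_congr rfl fun κ₁ _ => Finset.sum_congr rfl fun e _ => Finset.sum_congr rfl fun κ₂ _ =>
          Finset.sum_congr rfl fun e' _ => Finset.sum_congr rfl fun κ₃ _ => Finset.sum_congr rfl fun e'' _ => ?_
        rw [← hθ₂]; ring
      · simp only [sum_window_eq Lc x hP, Finset.mul_sum]
        refine Finset.sum_congr rfl fun κ₁ _ => Finset.sum_congr rfl fun e _ => Finset.sum_congr rfl fun κ₂ _ =>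
          Finset.sum_congr rfl fun e' _ => ?_
        rw [← hθ]; ring
      · simp only [sum_window_eq Lc x hP, Finset.mul_sum]
        refine Finset.sum_congr rfl fun κ₁ _ => Finset.sum_congr rfl fun e _ => Finset.sum_congr rfl fun κ₂ _ =>
          Finset.sum_congr rfl fun e' _ => ?_
        rw [← hθ]; ring
      · simp only [sum_window_eq Lc x hP, Finset.mul_sum]
        refine Finset.sum_congr rfl fun κ₁ _ => Finset.sum_congr rfl fun e _ => ?_
        rw [hu]; ring

/-! ## §3 F5-Sym: the order-2 Q-junction for the centred sym bricks -/

section Junction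

variable (hc : ctrOff (d + 1) Lc ∈ box (d + 1) Lc) (n : ℕ) (M : Fin (d + 1) → ℕ) [∀ μ, NeZero (M μ)] (lev : ℕ → ℕ) (rs : ℕ → (Fin (d + 1) → ℕ))
include hc

/-- [folklore] **F5-Sym — THE (C1) Q-JUNCTION, ORDER 2, ALL PAIRS OF COPIES, EVERY BOX** (`TorusCompositeInsertionKernelPackedSym` §2 at
`K₂ := compVH2Ker ℓˢ 𝓋ˢ 𝓋₂ˢ Lc n`, `cu := u_n`, `WK := winF (Lc^n) (wid Lc n)`, with `symKernelFunctionals₂_spec`'s triple and an2's three windows):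
`Σ_b Σ_{b′} h b · h′ b′ · Σ'_{m₁ m₂ m} (u_n • packVH (K₂ · · · (b.2, b.1 + T m₁) ·) (Lc^n) b′.2 (b′.1 + T m₂)) (Lc^n • x̄) (z + T m) (inr κ₀) (inl β) = compIns₂₂Sym Lc M lev rs n h h′ (x̄, κ₀) (z, β)`. -/
theorem sum_sum_mul_tsum₂_compVh2S_eq_compIns₂₂Sym_apply
    (h h' : ↥(pbox (towerTorus Lc M n)) × Fin (d + 1) → ℝ) (x : ↥(pbox M)) (κ₀ : Fin (d + 1)) (z : ↥(pbox (towerTorus Lc M n))) (β : Fin (d + 1)) :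
    ∑ b : ↥(pbox (towerTorus Lc M n)) × Fin (d + 1), ∑ b' : ↥(pbox (towerTorus Lc M n)) × Fin (d + 1), h b * (h' b' *
        ∑' m₁ : Site (d + 1), ∑' m₂ : Site (d + 1), ∑' m : Site (d + 1),
          (((∏ i ∈ range n, stepScale d Lc (lev (i + 1))) * ((box (d + 1) Lc).card : ℝ) ^ n) •
            packVH (fun μ y f f' => compVH2Ker (fun _ : ℕ => symLinKerAt (ctr (d + 1) Lc) Lc) (fun _ : ℕ => symVhKerAt (ctr (d + 1) Lc) Lc)
              (fun (_ : ℕ) μ y g g₁ g₂ => (1 / 2 : ℝ) * (symVh2KerAt (ctr (d + 1) Lc) Lc μ y g g₁ g₂ + symVh2KerAt (ctr (d + 1) Lc) Lc μ y g g₂ g₁)) Lc n μ y f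
                (b.2, translate (towerTorus Lc M n) (b.1 : Site (d + 1)) m₁) f') (Lc ^ n) b'.2 (translate (towerTorus Lc M n) (b'.1 : Site (d + 1)) m₂))
            ((((Lc ^ n : ℕ) : ℤ)) • (x : Site (d + 1))) (translate (towerTorus Lc M n) (z : Site (d + 1)) m) (Sum.inr κ₀) (Sum.inl β))
      = compIns₂₂Sym Lc M lev rs n h h' (x, κ₀) (z, β) := by
  obtain ⟨𝓡, 𝓘₁, 𝓘₂, hR0, hRsucc, h0₁, hsucc₁, h0₂, hsucc₂, h𝓘₂⟩ := symKernelFunctionals₂_spec (d := d) Lc hc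
  exact sum_sum_mul_tsum₂_packVH_eq_compIns₂₂Sym_apply Lc hc 𝓡 hR0 hRsucc 𝓘₁ h0₁ hsucc₁ 𝓘₂ h0₂ hsucc₂ n M lev rs
    (compVH2Ker (fun _ : ℕ => symLinKerAt (ctr (d + 1) Lc) Lc) (fun _ : ℕ => symVhKerAt (ctr (d + 1) Lc) Lc)
      (fun (_ : ℕ) μ y g g₁ g₂ => (1 / 2 : ℝ) * (symVh2KerAt (ctr (d + 1) Lc) Lc μ y g g₁ g₂ + symVh2KerAt (ctr (d + 1) Lc) Lc μ y g g₂ g₁)) Lc n)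
    ((∏ i ∈ range n, stepScale d Lc (lev (i + 1))) * ((box (d + 1) Lc).card : ℝ) ^ n) (winF (Lc ^ n) (wid Lc n))
    (fun μ y α f₁ f₂ w hw => compVH2Ker_eq_zero_fluct n (f := (α, w)) f₁ f₂ hw)
    (fun μ y f κ f₂ u hu => compVH2Ker_eq_zero_left n f (b := (κ, u)) f₂ hu)
    (fun μ y f f₁ κ' u' hu' => compVH2Ker_eq_zero_right n f f₁ (b' := (κ', u')) hu')
    (fun H H' B κ₀ x => h𝓘₂ lev n H H' B κ₀ x) h h' x κ₀ z β

/-- [folklore] **F5-Sym, ONE-PAIR SOCKET = the `-Sym` door's `hQF₂` AT THE ROW's SYM FAMILY, FOR BOXES BEYOND THE WINDOW** (`…PackedSym` §2 `…_single_of_diam` with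
`D := wid Lc n`; joint block covariance `hWt` by `packVH₂_translate` over an2's `compVH2Ker_sh` at an1's `symLinKerAt_add ∕ symVhKerAt_add ∕ symVh2KerAt_add`): if
`wid Lc n + |u i − u′ i| < T i` in every direction,
`perZ T (dper T (u_n • packVH (K₂ · · · (κ,u) ·) (Lc^n) κ′ u′)) (Lc^n • x̄) z (inr κ₀) (inl β) = compIns₂₂Sym Lc M lev rs n 𝟙_((wrapPt T u, κ)) 𝟙_((wrapPt T u′, κ′)) (x̄, κ₀) (z, β)`. -/
theorem perZ_dper_compVh2S_eq_compIns₂₂Sym_apply_single_of_lt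
    (κ : Fin (d + 1)) (u : Site (d + 1)) (κ' : Fin (d + 1)) (u' : Site (d + 1))
    (x : ↥(pbox M)) (κ₀ : Fin (d + 1)) (z : ↥(pbox (towerTorus Lc M n))) (β : Fin (d + 1))
    (hK : ∀ i : Fin (d + 1), (wid Lc n : ℤ) + |u i - u' i| < (towerTorus Lc M n i : ℤ)) :
    perZ (towerTorus Lc M n) (dper (towerTorus Lc M n)
        (((∏ i ∈ range n, stepScale d Lc (lev (i + 1))) * ((box (d + 1) Lc).card : ℝ) ^ n) •
          packVH (fun μ y f f' => compVH2Ker (fun _ : ℕ => symLinKerAt (ctr (d + 1) Lc) Lc) (fun _ : ℕ => symVhKerAt (ctr (d + 1) Lc) Lc)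
            (fun (_ : ℕ) μ y g g₁ g₂ => (1 / 2 : ℝ) * (symVh2KerAt (ctr (d + 1) Lc) Lc μ y g g₁ g₂ + symVh2KerAt (ctr (d + 1) Lc) Lc μ y g g₂ g₁)) Lc n μ y f (κ, u) f')
            (Lc ^ n) κ' u'))
        ((((Lc ^ n : ℕ) : ℤ)) • (x : Site (d + 1))) (z : Site (d + 1)) (Sum.inr κ₀) (Sum.inl β)
      = compIns₂₂Sym Lc M lev rs n (fun b => if b = (wrapPt (towerTorus Lc M n) u, κ) then 1 else 0)
          (fun b => if b = (wrapPt (towerTorus Lc M n) u', κ') then 1 else 0) (x, κ₀) (z, β) := by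
  obtain ⟨𝓡, 𝓘₁, 𝓘₂, hR0, hRsucc, h0₁, hsucc₁, h0₂, hsucc₂, h𝓘₂⟩ := symKernelFunctionals₂_spec (d := d) Lc hc
  have hLn : 1 ≤ Lc ^ n := Nat.one_le_pow n Lc (Nat.one_le_iff_ne_zero.mpr (NeZero.ne Lc))
  exact perZ_dper_packVH_eq_compIns₂₂Sym_apply_single_of_diam Lc hc 𝓡 hR0 hRsucc 𝓘₁ h0₁ hsucc₁ 𝓘₂ h0₂ hsucc₂ n M lev rs
    (compVH2Ker (fun _ : ℕ => symLinKerAt (ctr (d + 1) Lc) Lc) (fun _ : ℕ => symVhKerAt (ctr (d + 1) Lc) Lc)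
      (fun (_ : ℕ) μ y g g₁ g₂ => (1 / 2 : ℝ) * (symVh2KerAt (ctr (d + 1) Lc) Lc μ y g g₁ g₂ + symVh2KerAt (ctr (d + 1) Lc) Lc μ y g g₂ g₁)) Lc n)
    ((∏ i ∈ range n, stepScale d Lc (lev (i + 1))) * ((box (d + 1) Lc).card : ℝ) ^ n) (winF (Lc ^ n) (wid Lc n))
    (fun μ y α f₁ f₂ w hw => compVH2Ker_eq_zero_fluct n (f := (α, w)) f₁ f₂ hw)
    (fun μ y f κ f₂ u hu => compVH2Ker_eq_zero_left n f (b := (κ, u)) f₂ hu)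
    (fun μ y f f₁ κ' u' hu' => compVH2Ker_eq_zero_right n f f₁ (b' := (κ', u')) hu')
    (fun κ u κ' u' t => packVH₂_translate hLn
      (compVH2Ker (fun _ : ℕ => symLinKerAt (ctr (d + 1) Lc) Lc) (fun _ : ℕ => symVhKerAt (ctr (d + 1) Lc) Lc)
        (fun (_ : ℕ) μ y g g₁ g₂ => (1 / 2 : ℝ) * (symVh2KerAt (ctr (d + 1) Lc) Lc μ y g g₁ g₂ + symVh2KerAt (ctr (d + 1) Lc) Lc μ y g g₂ g₁)) Lc n)
      (fun μ y t f g g' => by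
        rw [Nat.cast_pow]
        exact compVH2Ker_sh (fun _ μ y t f => symLinKerAt_add (ctr (d + 1) Lc) Lc μ y t f) (fun _ μ y t f f' => symVhKerAt_add (ctr (d + 1) Lc) Lc μ y t f f')
          (fun _ μ y t g g' g'' => by simp only [symVh2KerAt_add]) n f g g' μ y t) κ u κ' u' t)
    (fun H H' B κ₀ x => h𝓘₂ lev n H H' B κ₀ x) κ u κ' u' x κ₀ z β (wid Lc n : ℤ)
    (fun v hv v' hv' i => abs_sub_le_of_mem_winF hv hv' i) hK

end Junction

end Summit.QuantumFields.BalabanUV.Beta.FP.TorusCompositeVertexJunctionTwoSym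

end
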